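import Summits.QuantumFields.YangMills.Theorems.UnitScaleTiltProp7OffsetFamilyWindow
import Summits.QuantumFields.YangMills.Theorems.UnitScaleTiltProp7PinnedSupOfGradient
import HarnessLib

/-!
# Route `UnitScaleTilt`, crux K1 «MinimiserStabilityRegPr» (stmt-QuantumFields-19200), route-R E′ path (α′), S3 K-form engine, row (R4′) — FILE 9n (T³ letters):
# THE (Kg′) FAMILY IN TRANSPORTED-PLAQUETTE LETTERS — ★p1 g16's display `Σ_fam ‖[P̃, φ₀(c_y)]‖²` (SIGN-IN 2026-08-28 23:01Z, word (3): «R4′ keeps ✓p675776's offset-comb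
# family; R5 displays hKg′-K(fam) : Σ_fam‖[P̃, φ₀(c_y)]‖² ≤ C_g′(fam)·K_W(Y) + θ_g′·e·ℓ⁻²·M(Y)»): the canonical letter of ✓p675053∕✓p675776,
# `‖[𝒲^(c^h_y)_q(w), R(𝒲^(c^h_y)(Γ_(0,q))⁻¹) R(𝒲([c_y,c^h_y])⁻¹) φ₀(c_y)]‖`, EQUALS `‖[P̃, φ₀(c_y)]‖` with `P̃ = R(𝒲(c_y; [c_y,c^h_y] ++ Γ_(0,q)))·𝒲_(c^h_y+q)(w)` — the plaquette word at
# `c^h_y + q` transported to the centre `c_y` along the family's path (segment, then comb) — by the isometry of the adjoint transport (✓ `norm_R_eq`); hence the (α) letter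
# ✓ `lemmaH_curved_offset_avg_count_windowed` restated with its Dirichlet family in these letters, ready to meet R5's row `hKg′-K(R4′-fam)`.

Cell `ym3-torus`, D-0154 (3c) twin-width seat `ym-routeR-w1` (gen 6); row (R4′) (★p1 g16 words (1)(3)(4); standing PASS R4′).  THEOREMS ONLY (0 `def`, 0 `sorry`);
`--supports stmt-QuantumFields-19200`, count-neutral.  YM₃ on T³ is a ladder rung (R3), not the Clay problem; nothing here claims a stub, the crux, d = 4 or the gap.

WHAT (ns `…Theorems.Prop7OffsetFamilyTransported`).
* §1 `comm_R_inv_eq` (`‖[A, R(U⁻¹)m]‖ = ‖[R(U)A, m]‖` for bi-contractive `U`, ✓ `norm_R_eq`), ★★ `canonical_letter_eq_transported` (any torus, bi-contractive `V`: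
  `‖[𝒱^(c₀+h·e_ι)_q(w), R(𝒱^(c₀+h·e_ι)(Γ_(0,q))⁻¹) R(𝒱(c₀; [ι]^h)⁻¹) m]‖ = ‖[R(𝒱(c₀; [ι]^h ++ Γ_(0,q))) 𝒱_(c₀+h·e_ι+q)(w), m]‖`, ✓ `hol_pull`, ✓ `holT_append`, ✓ `disp_seg`).
* §2 ★★★ `lemmaH_curved_offset_avg_count_transported` — ✓ `lemmaH_curved_offset_avg_count_windowed` with every letter of the (Kg′) family in the form `‖P̃·φ₀(c_y) − φ₀(c_y)·P̃‖²`.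
HONEST SCOPE.  Re-lettering only (an equality); no estimate; no booking against `K_gauge` (R5's row, the namer's pen).

References: T. Bałaban, CMP 99 (1985) 389–434 [Balaban1985BackgroundPropagators] ((3.1) p.390); CMP 98 (1985) 17–51 [Balaban1985Averaging] ((9) p.18, (19)–(20) p.21);
CMP 102 (1985) 255–275 [Balaban1985UV3] ((27) p.263).
-/

set_option autoImplicit false

noncomputable section

open scoped BigOperators Matrix.Norms.L2Operator Matrix

namespace Summit.QuantumFields.YangMills.Theorems.Prop7OffsetFamilyTransported

open Literature.MathematicalPhysics.QuantumFieldTheory.Balaban1983to89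
open Literature.MathematicalPhysics.QuantumFieldTheory.Balaban1983to89.T3ContinuumYM3Torus
open B7Prop1Explicit (Letter e seg treeWord hol disp_seg)
open B9Eq39Adjoint (R R_mul R_sub R_mul_R R_inv_R covD covDstar divB)
open B9TorusCalculus (torusT)
open B10Eq27TorusAxialLog (unitsField toUField holT axialT contourT rel pull transl hol_pull hol_pull_zero holT_append)
open B5Eq118OneStroke (iterBlockOf)
open B15DeterminingSets (embIter)
open Summit.QuantumFields.YangMills.Theorems.Prop7CovHodgeSplit (unitsField_toUField_mem_unitary)
open Summit.QuantumFields.YangMills.Theorems.Prop7LemmaHCurvedOfRows (bicontr_of_mem_unitary)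
open Summit.QuantumFields.YangMills.Theorems.Prop7AxialLocalModel (bicontr_holT)
open Summit.QuantumFields.YangMills.Theorems.Prop7PinnedSupOfGradient (norm_R_eq)
open Summit.QuantumFields.YangMills.Theorems.Prop7OffsetFamilyWindow (lemmaH_curved_offset_avg_count_windowed)

/-! ## §1 The canonical letter is a transported-plaquette commutator -/

section Algebra

variable {𝔸 : Type*} [NormedRing 𝔸]

/-- `‖[A, R(U⁻¹)m]‖ = ‖[R(U)A, m]‖` for bi-contractive `U` (the commutator is `R(U⁻¹)` of the other one; ✓ `norm_R_eq`). [cite: Balaban1985BackgroundPropagators, (3.1) p.390] -/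
theorem comm_R_inv_eq {U : 𝔸ˣ} (hU : ‖(U : 𝔸)‖ ≤ 1 ∧ ‖((U⁻¹ : 𝔸ˣ) : 𝔸)‖ ≤ 1) (A m : 𝔸) :
    ‖A * R U⁻¹ m - R U⁻¹ m * A‖ = ‖R U A * m - m * R U A‖ := by
  have e1 : A * R U⁻¹ m - R U⁻¹ m * A = R U⁻¹ (R U A * m - m * R U A) := by
    rw [R_sub, ← R_mul_R, ← R_mul_R, R_inv_R]
  have h2 : ‖(((U⁻¹)⁻¹ : 𝔸ˣ) : 𝔸)‖ ≤ 1 := by rw [inv_inv]; exact hU.1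
  rw [e1, norm_R_eq hU.2 h2]

end Algebra

section Torus

variable {𝔸 : Type*} [NormedRing 𝔸] [NormOneClass 𝔸] {P : Params} {j : ℕ} (V : GaugeField P j 𝔸ˣ)
  (hV : ∀ b : PBond P j, ‖(V b : 𝔸)‖ ≤ 1 ∧ ‖(((V b)⁻¹ : 𝔸ˣ) : 𝔸)‖ ≤ 1)

include hV in
/-- ★★ **THE CANONICAL LETTER IS A TRANSPORTED-PLAQUETTE COMMUTATOR**: with `c = c₀ + h·e_ι`, `𝒱^(c) = pull V c`,
`‖[𝒱^(c)_q(w), R(𝒱^(c)(Γ_(0,q))⁻¹) R(V(c₀; [ι]^h)⁻¹) m]‖ = ‖[R(V(c₀; [ι]^h ++ Γ_(0,q))) V_(c+q)(w), m]‖` — the word `w` at `c + q` transported to `c₀` along the segment-then-comb path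
(✓ `hol_pull`, ✓ `hol_pull_zero`, ✓ `holT_append`, ✓ `disp_seg`, §1). [cite: Balaban1985UV3, (27) p.263] [cite: Balaban1985Averaging, (9) p.18] -/
theorem canonical_letter_eq_transported (c₀ : Site P j) (ι : Fin P.d) (h : ℤ) (q : B7Prop1Explicit.Site P.d) (w : List (Letter P.d)) (m : 𝔸) :
    ‖((hol (pull V (transl c₀ (h • e ι))) q w : 𝔸ˣ) : 𝔸) * R (hol (pull V (transl c₀ (h • e ι))) 0 (treeWord q))⁻¹ (R (holT V c₀ (seg ι h))⁻¹ m)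
        - R (hol (pull V (transl c₀ (h • e ι))) 0 (treeWord q))⁻¹ (R (holT V c₀ (seg ι h))⁻¹ m) * ((hol (pull V (transl c₀ (h • e ι))) q w : 𝔸ˣ) : 𝔸)‖
      = ‖R (holT V c₀ (seg ι h ++ treeWord q)) ((holT V (transl (transl c₀ (h • e ι)) q) w : 𝔸ˣ) : 𝔸) * m
          - m * R (holT V c₀ (seg ι h ++ treeWord q)) ((holT V (transl (transl c₀ (h • e ι)) q) w : 𝔸ˣ) : 𝔸)‖ := by
  have hU := bicontr_holT V hV c₀ (seg ι h ++ treeWord q)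
  have hST : holT V c₀ (seg ι h) * holT V (transl c₀ (h • e ι)) (treeWord q) = holT V c₀ (seg ι h ++ treeWord q) := by
    rw [holT_append, disp_seg]
  rw [hol_pull, hol_pull_zero, ← B9Eq39Adjoint.R_mul, ← mul_inv_rev, hST]
  exact comm_R_inv_eq hU _ _

end Torus

/-! ## §2 The (α) letter in transported-plaquette letters -/

section T3

/-- ★★★ **THE (α) LETTER IN TRANSPORTED-PLAQUETTE LETTERS**: ✓ `lemmaH_curved_offset_avg_count_windowed` (✓p676499) with every letter of its (Kg′) family rewritten by
✓ `canonical_letter_eq_transported`: the family is `Σ_y ℓ′⁻¹Σ_(h<ℓ′) 2·Σ_μ (|t_μ|R)·Σ_(i<|t_μ|)(2R+1)^(|t_μ|−i)·Σ_(q∈[−R,R]^d) Σ_± ‖P̃ φ₀(c_y) − φ₀(c_y) P̃‖²` with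
`P̃ = R(𝒲(c_y; [ι]^h ++ Γ_(0,q)))·𝒲_(c^h_y+q)((t_(μ,i),±) μ (t_(μ,i),±)⁻ μ⁻)` — the plaquette word at `c^h_y + q` transported to the centre `c_y` along the offset-comb path, against
`φ₀(c_y) = ψ(embIter y)`; `R = 2ℓ + ℓ′`.  This is the `Σ_fam‖[P̃, φ₀(c_y)]‖²` of ★p1 g16's row `hKg′-K(R4′-fam)`; remaining displayed rows `hψ`, `hG`, splits.
[cite: Balaban1985Averaging, (9) p.18, (19)–(20) p.21, p.24] [cite: Balaban1985UV3, (27) p.263] [cite: Balaban1985BackgroundPropagators, (3.1) p.390] -/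
theorem lemmaH_curved_offset_avg_count_transported (F : T3Family) (K n : ℕ) (hk : K - n ≤ (F.P K).m + (F.P K).K) (hℓ2 : 2 ≤ (F.P K).L ^ (K - n))
    (W : GaugeField (F.P K) 0 (Matrix.specialUnitaryGroup (Fin 2) ℂ)) (ψ : Site (F.P K) 0 → Matrix (Fin 2) (Fin 2) ℂ)
    (hψ : ∀ x : Site (F.P K) 0, x ∉ Set.range (embIter (K - n)) →
      divB (torusT (F.P K) 0) (fun κ z => unitsField (toUField W) ⟨z, κ⟩) (fun κ y => covD (torusT (F.P K) 0) (fun κ z => unitsField (toUField W) ⟨z, κ⟩) κ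
        (fun z => divB (torusT (F.P K) 0) (fun κ z => unitsField (toUField W) ⟨z, κ⟩)
          (fun ν w => covD (torusT (F.P K) 0) (fun κ z => unitsField (toUField W) ⟨z, κ⟩) ν ψ w) z) y) x = 0)
    (ι : Fin (F.P K).d) (ℓ' : ℕ) [NeZero ℓ'] (hN : (2 * (F.P K).L ^ (K - n) + ℓ') * 2 < (F.P K).sitesPerDir 0)
    (Z : Fin (F.P K).d → Site (F.P K) 0 → Matrix (Fin 2) (Fin 2) ℂ) (G : Site (F.P K) (K - n) → ℝ)
    (hG : ∀ (y : Site (F.P K) (K - n)) (z : Site (F.P K) 0),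
      (∀ ν : Fin (F.P K).d,
        (y ν = (iterBlockOf (K - n) (fun κ => z κ - (((((F.P K).L ^ (K - n) - 1) / 2 : ℕ)) : ZMod ((F.P K).sitesPerDir 0)))) ν - 1
        ∨ y ν = (iterBlockOf (K - n) (fun κ => z κ - (((((F.P K).L ^ (K - n) - 1) / 2 : ℕ)) : ZMod ((F.P K).sitesPerDir 0)))) ν
        ∨ y ν = (iterBlockOf (K - n) (fun κ => z κ - (((((F.P K).L ^ (K - n) - 1) / 2 : ℕ)) : ZMod ((F.P K).sitesPerDir 0)))) ν + 1
        ∨ y ν = (iterBlockOf (K - n) (fun κ => z κ - (((((F.P K).L ^ (K - n) - 1) / 2 : ℕ)) : ZMod ((F.P K).sitesPerDir 0)))) ν + 2)) →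
      ∀ μ : Fin (F.P K).d, ‖(ℓ' : ℝ)⁻¹ • ∑ η : Fin ℓ', R (axialT (unitsField (toUField W)) (transl (embIter (K - n) y) (((η : ℕ) : ℤ) • e ι)) z)⁻¹ (R (holT (unitsField (toUField W)) (embIter (K - n) y) (seg ι ((η : ℕ) : ℤ)))⁻¹ (ψ (embIter (K - n) y))) - Z μ z‖ ≤ G y)
    (s t : Fin (F.P K).d → List (Fin (F.P K).d)) (hsplit : ∀ μ, (List.finRange (F.P K).d).reverse = s μ ++ μ :: t μ) (hs : ∀ μ, μ ∉ s μ) (ht : ∀ μ, μ ∉ t μ) :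
    (F.L : ℝ) ^ (K - n) * ∑ x : Site (F.P K) 0, ∑ a : Fin 2, ∑ b : Fin 2,
        Complex.normSq ((divB (torusT (F.P K) 0) (fun κ z => unitsField (toUField W) ⟨z, κ⟩)
          (fun κ y => covD (torusT (F.P K) 0) (fun κ z => unitsField (toUField W) ⟨z, κ⟩) κ ψ y) x) a b)
      ≤ (F.L : ℝ) ^ (K - n) * (2 * (
          3 * ∑ y : Site (F.P K) (K - n), ∑ z : Site (F.P K) 0,
            (if (∀ ν : Fin (F.P K).d,
                (y ν = (iterBlockOf (K - n) (fun κ => z κ - (((((F.P K).L ^ (K - n) - 1) / 2 : ℕ)) : ZMod ((F.P K).sitesPerDir 0)))) ν - 1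
                ∨ y ν = (iterBlockOf (K - n) (fun κ => z κ - (((((F.P K).L ^ (K - n) - 1) / 2 : ℕ)) : ZMod ((F.P K).sitesPerDir 0)))) ν
                ∨ y ν = (iterBlockOf (K - n) (fun κ => z κ - (((((F.P K).L ^ (K - n) - 1) / 2 : ℕ)) : ZMod ((F.P K).sitesPerDir 0)))) ν + 1
                ∨ y ν = (iterBlockOf (K - n) (fun κ => z κ - (((((F.P K).L ^ (K - n) - 1) / 2 : ℕ)) : ZMod ((F.P K).sitesPerDir 0)))) ν + 2))
              then (ℓ' : ℝ)⁻¹ * ∑ η : Fin ℓ', (∑ μ : Fin (F.P K).d,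
                      (‖(((holT (unitsField (toUField W)) (transl (embIter (K - n) y) (((η : ℕ) : ℤ) • e ι)) (contourT (transl (embIter (K - n) y) (((η : ℕ) : ℤ) • e ι)) ⟨(torusT (F.P K) 0 μ).symm z, μ⟩))⁻¹
                            * holT (unitsField (toUField W)) (transl (embIter (K - n) y) (((η : ℕ) : ℤ) • e ι)) (contourT (transl (embIter (K - n) y) (((η : ℕ) : ℤ) • e ι)) ⟨z, μ⟩) : (Matrix (Fin 2) (Fin 2) ℂ)ˣ) : Matrix (Fin 2) (Fin 2) ℂ) * R (holT (unitsField (toUField W)) (embIter (K - n) y) (seg ι ((η : ℕ) : ℤ)))⁻¹ (ψ (embIter (K - n) y))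
                        - R (holT (unitsField (toUField W)) (embIter (K - n) y) (seg ι ((η : ℕ) : ℤ)))⁻¹ (ψ (embIter (K - n) y)) * (((holT (unitsField (toUField W)) (transl (embIter (K - n) y) (((η : ℕ) : ℤ) • e ι)) (contourT (transl (embIter (K - n) y) (((η : ℕ) : ℤ) • e ι)) ⟨(torusT (F.P K) 0 μ).symm z, μ⟩))⁻¹
                            * holT (unitsField (toUField W)) (transl (embIter (K - n) y) (((η : ℕ) : ℤ) • e ι)) (contourT (transl (embIter (K - n) y) (((η : ℕ) : ℤ) • e ι)) ⟨z, μ⟩) : (Matrix (Fin 2) (Fin 2) ℂ)ˣ) : Matrix (Fin 2) (Fin 2) ℂ)‖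
                        + 2 * ‖((holT (unitsField (toUField W)) (transl (embIter (K - n) y) (((η : ℕ) : ℤ) • e ι)) (contourT (transl (embIter (K - n) y) (((η : ℕ) : ℤ) • e ι)) ⟨(torusT (F.P K) 0 μ).symm z, μ⟩) :
                                (Matrix (Fin 2) (Fin 2) ℂ)ˣ) : Matrix (Fin 2) (Fin 2) ℂ) - 1‖
                          * ‖((holT (unitsField (toUField W)) (transl (embIter (K - n) y) (((η : ℕ) : ℤ) • e ι)) (contourT (transl (embIter (K - n) y) (((η : ℕ) : ℤ) • e ι)) ⟨(torusT (F.P K) 0 μ).symm z, μ⟩) :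
                                (Matrix (Fin 2) (Fin 2) ℂ)ˣ) : Matrix (Fin 2) (Fin 2) ℂ) * R (holT (unitsField (toUField W)) (embIter (K - n) y) (seg ι ((η : ℕ) : ℤ)))⁻¹ (ψ (embIter (K - n) y))
                              - R (holT (unitsField (toUField W)) (embIter (K - n) y) (seg ι ((η : ℕ) : ℤ)))⁻¹ (ψ (embIter (K - n) y)) * ((holT (unitsField (toUField W)) (transl (embIter (K - n) y) (((η : ℕ) : ℤ) • e ι)) (contourT (transl (embIter (K - n) y) (((η : ℕ) : ℤ) • e ι)) ⟨(torusT (F.P K) 0 μ).symm z, μ⟩) :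
                                (Matrix (Fin 2) (Fin 2) ℂ)ˣ) : Matrix (Fin 2) (Fin 2) ℂ)‖)) ^ 2
              else 0)
          + 3 * (2 * ((F.P K).d : ℝ) * (6 / ((((F.P K).L ^ (K - n) : ℕ) : ℝ)))) * (3 / ((((F.P K).L ^ (K - n) : ℕ) : ℝ)))
            * ∑ y : Site (F.P K) (K - n), (ℓ' : ℝ)⁻¹ * ∑ η : Fin ℓ', (2 * ∑ μ : Fin (F.P K).d,
              ((((t μ).length * (2 * (F.P K).L ^ (K - n) + ℓ') : ℕ) : ℝ) * ∑ i ∈ Finset.range (t μ).length, (((2 * (2 * (F.P K).L ^ (K - n) + ℓ') + 1) ^ ((t μ).length - i) : ℕ) : ℝ)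
                * ∑ q ∈ Fintype.piFinset (fun _ : Fin (F.P K).d => Finset.Icc (-((2 * (F.P K).L ^ (K - n) + ℓ') : ℤ)) ((2 * (F.P K).L ^ (K - n) + ℓ') : ℤ)),
                    (‖R (holT (unitsField (toUField W)) (embIter (K - n) y) (seg ι ((η : ℕ) : ℤ) ++ treeWord q))
                          ((holT (unitsField (toUField W)) (transl (transl (embIter (K - n) y) (((η : ℕ) : ℤ) • e ι)) q) [((t μ).getD i μ, true), (μ, true), Letter.rev ((t μ).getD i μ, true), (μ, false)] : (Matrix (Fin 2) (Fin 2) ℂ)ˣ) : Matrix (Fin 2) (Fin 2) ℂ)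
                        * ψ (embIter (K - n) y)
                      - ψ (embIter (K - n) y)
                        * R (holT (unitsField (toUField W)) (embIter (K - n) y) (seg ι ((η : ℕ) : ℤ) ++ treeWord q))
                          ((holT (unitsField (toUField W)) (transl (transl (embIter (K - n) y) (((η : ℕ) : ℤ) • e ι)) q) [((t μ).getD i μ, true), (μ, true), Letter.rev ((t μ).getD i μ, true), (μ, false)] : (Matrix (Fin 2) (Fin 2) ℂ)ˣ) : Matrix (Fin 2) (Fin 2) ℂ)‖ ^ 2
                    + ‖R (holT (unitsField (toUField W)) (embIter (K - n) y) (seg ι ((η : ℕ) : ℤ) ++ treeWord q))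
                          ((holT (unitsField (toUField W)) (transl (transl (embIter (K - n) y) (((η : ℕ) : ℤ) • e ι)) q) [((t μ).getD i μ, false), (μ, true), Letter.rev ((t μ).getD i μ, false), (μ, false)] : (Matrix (Fin 2) (Fin 2) ℂ)ˣ) : Matrix (Fin 2) (Fin 2) ℂ)
                        * ψ (embIter (K - n) y)
                      - ψ (embIter (K - n) y)
                        * R (holT (unitsField (toUField W)) (embIter (K - n) y) (seg ι ((η : ℕ) : ℤ) ++ treeWord q))
                          ((holT (unitsField (toUField W)) (transl (transl (embIter (K - n) y) (((η : ℕ) : ℤ) • e ι)) q) [((t μ).getD i μ, false), (μ, true), Letter.rev ((t μ).getD i μ, false), (μ, false)] : (Matrix (Fin 2) (Fin 2) ℂ)ˣ) : Matrix (Fin 2) (Fin 2) ℂ)‖ ^ 2)))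
          + 3 * ((F.P K).d : ℝ) ^ 2 * (24 / ((((F.P K).L ^ (K - n) : ℕ) : ℝ)) ^ 2)
            * (24 / ((((F.P K).L ^ (K - n) : ℕ) : ℝ)) ^ 2 * ((((F.P K).L ^ (K - n) : ℕ) : ℝ)) ^ (F.P K).d) * ∑ y : Site (F.P K) (K - n), G y ^ 2)) := by
  have hV : ∀ b : PBond (F.P K) 0, ‖((unitsField (toUField W) b : (Matrix (Fin 2) (Fin 2) ℂ)ˣ) : Matrix (Fin 2) (Fin 2) ℂ)‖ ≤ 1
      ∧ ‖(((unitsField (toUField W) b)⁻¹ : (Matrix (Fin 2) (Fin 2) ℂ)ˣ) : Matrix (Fin 2) (Fin 2) ℂ)‖ ≤ 1 :=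
    fun b => bicontr_of_mem_unitary _ (unitsField_toUField_mem_unitary W b.dir b.src)
  have main := lemmaH_curved_offset_avg_count_windowed F K n hk hℓ2 W ψ hψ ι ℓ' hN Z G hG s t hsplit hs ht
  simpa only [canonical_letter_eq_transported (unitsField (toUField W)) hV] using main

end T3

end Summit.QuantumFields.YangMills.Theorems.Prop7OffsetFamilyTransported

end
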